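import Literature.MathematicalPhysics.QuantumFieldTheory.Balaban1983to89.B1Cor23DerivRegularRegion
import Literature.MathematicalPhysics.QuantumFieldTheory.Balaban1983to89.B1Prop22RegularRegionFam
import Literature.MathematicalPhysics.QuantumFieldTheory.Balaban1983to89.B1Claim18RegularTorusFam

/-!
# `Balaban1983to89.B1Cor23RegularDiagFam` — [Balaban1983RegularityDecay] **COROLLARY 2.3 (2.30)** p. 580, TYPED (`B4.Cor23Printed`, b04's carrier
# `B4.EtaSetting`), **INHABITED BY THE (Higgs)₂,₃ CARRIER AT EVERY VECTOR FIELD (2.23)-REGULAR ON A REGION `Ω ⊂ T_ε`, FOR THE DIAGONAL PAIRS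
# `Ω₀ = Ω`**: the four pairings `⟨f, G_k(Ω,A)f′⟩`, `⟨f, D^η_{A,μ}G_k(Ω,A)f′⟩`, `⟨f, G_k(Ω,A)D^{η*}_{A,ν}f′⟩`, `⟨f, D^η_{A,μ}G_k(Ω,A)D^{η*}_{A,ν}f′⟩` of the
# CONCRETE propagator `G^ε_k(Ω,A) = HiggsCovariance.propagatorK C Ω A m² a k` ([Balaban1982Higgs1] (2.20)) for fields defined on `Ω` (any union of
# `k`-fold blocks, any level `1 ≤ k ≤ K` with `L^kε ≤ 1`, any torus), bounded by `c₀e^{−δ₀dist(supp f, supp f′)}‖f‖₂‖f′‖₂` with `(δ₀, c₀, e₁)` BEFORE the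
# member — r14 g14's `B1Cor23RegularRegion.cor23_first_regular_region` (p322845) and `B1Cor23DerivRegularRegion.cor23_deriv_regular_region` (p325528)
# packaged in b04's typed form; the `δG_k(Ω,Ω₀,A)` clauses hold on the diagonal because `δG_k(Ω,Ω,A) = 0` LITERALLY (the functional is the pairing
# of `G^ε_k(Ω,A) − G^ε_k(Ω,A)`)

statement-level skeleton of published theorems with citation tags; proofs where landed; nothing here is a claim about the Yang–Mills mass gap

PDF held: `paper:balaban1983-cmp89-regularity-decay` p. 580 [PDF 10] (Cor. 2.3 (2.30)), p. 572–573 [PDF 2–3] ((1.3)–(1.8), (1.11)–(1.12) `δG_k`);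
[Balaban1982Higgs1] = `paper:balaban1982-cmp85-higgs23-i` p. 605 [PDF 3] (1.7), p. 610 [PDF 8] (2.20)–(2.23).

CITATION HEADER (lean-in-tree rule).  T. Bałaban, *Regularity and decay of lattice Green's functions*, Commun. Math. Phys. **89** (1983) 571–597
[Balaban1983RegularityDecay], Cor. 2.3 (2.30) p. 580; T. Bałaban, *(Higgs)₂,₃ quantum fields in a finite volume. I*, Commun. Math. Phys. **85** (1982)
603–626 [Balaban1982Higgs1], (1.7) p. 605, (2.20), Prop. 2.1 (2.23) p. 610.  Cell `lit-balaban` (HOME `run/shared/lean/pub/lit-balaban/`), reader/typer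
seat **r14** gen 14 (unit `lit-balaban-r14`; TAKING line HOME/STATUS.md 2026-08-22T07:18:39Z); SKELETON rows **B1.Prop2.3 / B1.Prop2.1** (cells: the
`L²`-version of Prop. I.2.1 = the input of (2.34)/(2.38)) and r01's **B4.Cor2.3** (MODEL-INSTANCE cell only, no head change; decl of record
`B4.Cor23Printed` is b04's, r01's instances `B4Cor23RegionPairFam`/`B4Cor23TorusPairFam` are on the b04 carrier).  USED BY NAME, never restated: b04
`B4.{EtaSetting, Cor23Printed}`; r14 g14 `B1Cor23RegularRegion.cor23_first_regular_region`, `B1Cor23DerivRegularRegion.cor23_deriv_regular_region`,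
`B1Prop22RegularRegionFam.exists_deltaA_of_reg223`; p35 g11 `B1Claim18RegularTorusFam.threshold_reg223`; typer `HiggsLattice`, `HiggsCovariance.propagatorK`,
`HiggsCovariancePos.sum_site_dir`, `B1Ineq234LevelZero.{tdist_comm, tdist_triangle_real, tdist_shift_le_one}`.

WHAT IS PRINTED (verbatim, [13] p. 580 [PDF 10]): *"Corollary 2.3. If Ω and A are as in Proposition I.2.1, then there exist positive constants c₀, δ₀
such that for arbitrary scalar field configurations f, f′ defined on Ω, we have |⟨f, G_k(Ω,A)f′⟩|, |⟨f, D^η_{A,μ}G_k(Ω,A)f′⟩|, |⟨f, G_k(Ω,A)D^{η*}_{A,ν}f′⟩|,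
|⟨f, D^η_{A,μ}G_k(Ω,A)D^{η*}_{A,ν}f′⟩| ≤ c₀e^{−δ₀dist(supp f, supp f′)}‖f‖₂‖f′‖₂. (2.30)"*; p. 581 L1–2 [PDF 11]
(re-keyed in v1.1, doc-only, referee note S-B1-g46-1 — v1.0 carried here a PARAPHRASE (ours) «the corresponding expressions with δG_k … the
right side of (2.30) multiplied by …» inside the quotation marks): *"The same inequalities hold for δG_k(Ω,Ω₀,A) with the additional factor
e^{−δ₀(dist(supp f,Ωᶜ)+dist(supp f′,Ωᶜ))}"*; p. 573 (1.11): *"δG_k(Ω,Ω₀,A) = G_k(Ω,A) − G_k(Ω₀,A)"* for `Ω ⊂ Ω₀`.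

THE FAMILY (dictionary of each field of `B4.EtaSetting`).  Index `i` = a torus `P` (`P.d = d`, `P.L = L`), a level `1 ≤ k ≤ K_P` with `L^kε ≤ 1`, a
region `Ω ⊂ T_ε` that is a union of `k`-fold blocks (`hΩ`; [13]'s standing «unions of big blocks», here WEAKER), a vector field `A`, an effective coupling
`e_k`; the PAIR of regions of the member is `(Ω, Ω₀) = (Ω, Ω)` (diagonal).  `Src` := fields on `T_ε` vanishing off `Ω` (*"defined on Ω"*); `Dir := Fin d`;
`e := e_k`; `regular` := (2.23) bond by bond at the sites of `Ω` in p35's rescaled form `(L^kε|e|/e_k)|A_μ(z + εe_ν) − A_μ(z)| ≦ c·e_k^{β−1}/L^k`;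
`bigBlocks := True` (block-union is in the index), `rect := False`; `l2Norm := ‖·‖₂` ((1.5)); `ssdist f f′ := dist(supp f, supp f′)` in `η = L^{−k}`-units
(`ssdistSteps/L^k`, `0` if a support is empty); `bdistS := 0` (only enters the `δG` clauses, which vanish identically here); **`pair n μ ν f f′`**, `n =
0,1,2,3` := `|⟨f, G f′⟩|`, `|⟨h_{f,μ}, D^ε_AG f′⟩_{bonds}|`, `|⟨f, G D^{ε*}_Ah_{f′,ν}⟩|`, `|⟨h_{f,μ}, D^ε_AG D^{ε*}_Ah_{f′,ν}⟩_{bonds}|` with `G = G^ε_k(Ω,A)`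
UNSCALED ((2.20); the rescaling (2.22) to the unit lattice multiplies pairing `n` by `(L^kε)^{n−2}`-type powers — with `L^kε ≤ 1` the printed
`η`-lattice bounds follow for `n = 0, 1, 2` up to these powers ≤ 1, and `n = 3` carries no power; see HONEST SCOPE (iii)), where `h_{f,μ}` is the bond
field `b ↦ 1[b ⊂ Ω, dir b = μ]f(b₋)` (the `μ`-th component pairing of print) and `D^{ε*}_A` the explicit (1.5)-adjoint of `B1Cor23DerivRegularRegion`;
**`dpair n μ ν f f′`** := the same four pairings with `G^ε_k(Ω,A) − G^ε_k(Ω₀,A)`, `Ω₀ := Ω`, in place of `G` — LITERALLY the difference of the two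
propagators (equal here), so `dpair = 0` is a one-line theorem, not a definition; the remaining (1.9)–(1.12)/(1.8) functionals (`lhs19`, `valDG`, `valG`,
`dlhs19`, `dvalDG`, `dvalG`, `lower18`, the point distances) are dummies — THIS family serves (2.30) only ((1.8) for regions: `B1Claim18RegularRegionFam`;
the Theorem for regions: p35's region-cube programme).

WHAT THIS FILE PROVES (kernel-checked, zero `sorry`; axioms standard).
* §1 `suppF`, `ssdistSteps` (+ `ssdistSteps_le`; private `ssdistSteps_nonneg`), `bf` (the bond field `h_{f,μ}`, + `bondInner_bf_le`,
  `sqrt_bondInner_bf_le`; private `bf_eq_zero_of_not_inside`, `bf_ne_zero`), `adjA` (the explicit `D^{ε*}_A`).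
* §2 `Cor23Idx` (+ `SrcΩ`, `G`, `dG`, **`pairT`** — the four pairings for an operator `T`; private `pairT_zero`), **`regDiagFam23`** (the family, all fields
  with bodies), `dpair_eq_zero`.
* §3 **`cor23Printed_regDiagFam23`**: for `d`, `L ≧ 2`, `a > 0`, `m² > 0`, `N`, `(e, q)`, `c ≧ 0`, `β > 0`: `B4.Cor23Printed (regDiagFam23 d L C a m² c β)` —
  constants `δ₀ = min{δ₁, δ₂}`, `c₀ = (c₁ + c₂)e^{δ₂}`, `e₁ = (3(d²c + 1))^{−1/β}` from r14 g14's two printed-shape theorems (elaboration-heavy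
  case analysis: explicit heartbeat budget `800000`); `regDiagFam23_nonvacuous`.
HONEST SCOPE.  (i) MODEL INSTANCE of the typed (2.30) on the concrete carrier; no head claim on row B4.Cor2.3 (r01's).  (ii) **DIAGONAL PAIRS ONLY**:
the member's `Ω₀` is `Ω` itself, so the printed `δG_k(Ω,Ω₀,A)` clauses are the trivial case `δG = 0`; the OFF-DIAGONAL `δG` pairings for `Ω ⊊ Ω₀` at
a regular `A` on the concrete carrier are NOT in the tree (open in this lane — see HOME/lit-balaban-r14/HANDOFF.md gen-14 NEXT).  (iii) CURRENCY: the
pairings are those of the UNSCALED `ε`-lattice propagator (2.20) with `ε`-lattice scalar products; the bounds proved by r14 carry `(L^kε)²`, `(L^kε)`, `(L^kε)`,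
`1` for `n = 0,1,2,3`, absorbed into `c₀` using `L^kε ≤ 1` (index field `hs`), exactly as in the printed-shape theorems consumed.  (iv) `Ω` any union of
`k`-fold blocks; regularity at the sites of `Ω`; threshold r14's crude `d²·c·e_k^β ≦ 1/3`; `m² > 0` for invertibility.  (v) METHOD of the inputs:
Combes–Thomas, not the print's random walk.  (vi) NOT summit progress.
-/

noncomputable section

open scoped BigOperators InnerProductSpace

namespace Literature.MathematicalPhysics.QuantumFieldTheory.Balaban1983to89.B1Cor23RegularDiagFam

open HiggsLattice HiggsAveraging HiggsCovariance HiggsCovariancePos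
open B1Ineq234LevelZero (tdist_comm tdist_triangle_real tdist_shift_le_one)
open B1Cor23RegularRegion (cor23_first_regular_region)
open B1Cor23DerivRegularRegion (cor23_deriv_regular_region)
open B1Prop22RegularRegionFam (exists_deltaA_of_reg223)
open B1Claim18RegularTorusFam (threshold_reg223)
open B4 (EtaSetting Cor23Printed)

variable {P : HiggsLattice.Params} {N : ℕ}

/-! ## §1 Supports, the support distance, the component bond fields, the adjoint derivative -/

section Support

open Classical in
/-- `supp f ⊂ T_ε`. [cite: Balaban1983RegularityDecay, Cor. 2.3 (2.30) p.580 «dist(supp f, supp f′)»] -/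
def suppF (f : ScalarField P 0 N) : Finset (HiggsLattice.Site P 0) := Finset.univ.filter fun x => f x ≠ 0

open Classical in
/-- `dist(supp f, supp f′)` in lattice steps of `T_ε` (`0` if a support is empty). [cite: Balaban1983RegularityDecay, Cor. 2.3 (2.30) p.580] -/
def ssdistSteps (f f' : ScalarField P 0 N) : ℝ :=
  if h : (suppF f ×ˢ suppF f').Nonempty then
    (((suppF f ×ˢ suppF f').inf' h fun p => HiggsLattice.Site.tdist p.1 p.2 : ℕ) : ℝ) else 0

/-- `dist(supp f, supp f′) ≤ |x − x′|` for `f(x) ≠ 0 ≠ f′(x′)`. [cite: Balaban1983RegularityDecay, (1.3) p.572] -/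
theorem ssdistSteps_le {f f' : ScalarField P 0 N} {x x' : HiggsLattice.Site P 0} (hx : f x ≠ 0) (hx' : f' x' ≠ 0) :
    ssdistSteps f f' ≤ (HiggsLattice.Site.tdist x x' : ℝ) := by
  classical
  have hmem : (x, x') ∈ suppF f ×ˢ suppF f' := by
    rw [Finset.mem_product]
    exact ⟨Finset.mem_filter.2 ⟨Finset.mem_univ _, hx⟩, Finset.mem_filter.2 ⟨Finset.mem_univ _, hx'⟩⟩
  have hne : (suppF f ×ˢ suppF f').Nonempty := ⟨_, hmem⟩
  unfold ssdistSteps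
  rw [dif_pos hne]
  exact_mod_cast Finset.inf'_le (fun p : HiggsLattice.Site P 0 × HiggsLattice.Site P 0 => HiggsLattice.Site.tdist p.1 p.2) hmem

/-- `dist(supp f, supp f′) ≥ 0`. [folklore] -/
private theorem ssdistSteps_nonneg (f f' : ScalarField P 0 N) : 0 ≤ ssdistSteps f f' := by
  unfold ssdistSteps; split_ifs <;> positivity

/-- The `μ`-th COMPONENT BOND FIELD of a site field on `Ω`: `h_{f,μ}(b) = f(b₋)` on the bonds `b ⊂ Ω` of direction `μ`, `0` elsewhere — so that
`⟨h_{f,μ}, D^ε_Aψ⟩_{bonds} = ⟨f, (D^ε_{A,μ}ψ)⟩` on `Ω`. [cite: Balaban1983RegularityDecay, (1.4) p.572, Cor. 2.3 (2.30) p.580] -/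
def bf (Ω : Finset (HiggsLattice.Site P 0)) (μ : Fin P.d) (f : ScalarField P 0 N) : HiggsLattice.PBond P 0 → E N :=
  fun b => if Inside Ω b ∧ b.dir = μ then f b.src else 0

/-- `h_{f,μ}` vanishes off the bonds inside `Ω`. [folklore] -/
private theorem bf_eq_zero_of_not_inside (Ω : Finset (HiggsLattice.Site P 0)) (μ : Fin P.d) (f : ScalarField P 0 N)
    (b : HiggsLattice.PBond P 0) (hb : ¬ Inside Ω b) : bf Ω μ f b = 0 := by
  unfold bf
  rw [if_neg (fun h => hb h.1)]

/-- `h_{f,μ}(b) ≠ 0 ⇒ f(b₋) ≠ 0`. [folklore] -/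
private theorem bf_ne_zero {Ω : Finset (HiggsLattice.Site P 0)} {μ : Fin P.d} {f : ScalarField P 0 N} {b : HiggsLattice.PBond P 0}
    (hb : bf Ω μ f b ≠ 0) : f b.src ≠ 0 := by
  unfold bf at hb
  split_ifs at hb with h
  · exact hb
  · exact absurd rfl hb

/-- `‖h_{f,μ}‖² ≤ ‖f‖²` (one direction of the bonds, (1.5)). [cite: Balaban1982Higgs1, (1.5) p.604] -/
theorem bondInner_bf_le (Ω : Finset (HiggsLattice.Site P 0)) (μ : Fin P.d) (f : ScalarField P 0 N) :
    bondInner (bf Ω μ f) (bf Ω μ f) ≤ siteInner f f := by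
  classical
  have hmd : 0 ≤ P.mesh 0 ^ P.d := pow_nonneg (P.mesh_pos 0).le _
  unfold bondInner siteInner
  rw [← sum_site_dir (fun x ν => P.mesh 0 ^ P.d * ⟪bf Ω μ f ⟨x, ν⟩, bf Ω μ f ⟨x, ν⟩⟫_ℝ)]
  refine Finset.sum_le_sum fun x _ => ?_
  have hterm : ∀ ν : Fin P.d, P.mesh 0 ^ P.d * ⟪bf Ω μ f ⟨x, ν⟩, bf Ω μ f ⟨x, ν⟩⟫_ℝ
      ≤ if ν = μ then P.mesh 0 ^ P.d * ⟪f x, f x⟫_ℝ else 0 := by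
    intro ν
    unfold bf
    by_cases hν : ν = μ
    · rw [if_pos hν]
      split_ifs with h
      · exact le_rfl
      · rw [inner_zero_left, mul_zero]
        exact mul_nonneg hmd real_inner_self_nonneg
    · rw [if_neg hν]
      have : ¬ (Inside Ω (⟨x, ν⟩ : HiggsLattice.PBond P 0) ∧ (⟨x, ν⟩ : HiggsLattice.PBond P 0).dir = μ) := fun h => hν h.2
      rw [if_neg this, inner_zero_left, mul_zero]
  calc ∑ ν : Fin P.d, P.mesh 0 ^ P.d * ⟪bf Ω μ f ⟨x, ν⟩, bf Ω μ f ⟨x, ν⟩⟫_ℝ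
      ≤ ∑ ν : Fin P.d, (if ν = μ then P.mesh 0 ^ P.d * ⟪f x, f x⟫_ℝ else 0) := Finset.sum_le_sum fun ν _ => hterm ν
    _ = P.mesh 0 ^ P.d * ⟪f x, f x⟫_ℝ := by rw [Finset.sum_ite_eq' Finset.univ μ, if_pos (Finset.mem_univ _)]

/-- `‖h_{f,μ}‖ ≤ ‖f‖`. [cite: Balaban1982Higgs1, (1.5) p.604] -/
theorem sqrt_bondInner_bf_le (Ω : Finset (HiggsLattice.Site P 0)) (μ : Fin P.d) (f : ScalarField P 0 N) :
    Real.sqrt (bondInner (bf Ω μ f) (bf Ω μ f)) ≤ Real.sqrt (siteInner f f) :=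
  Real.sqrt_le_sqrt (bondInner_bf_le Ω μ f)

/-- The explicit (1.5)-adjoint covariant derivative `(D^{ε*}_Ah)(x) = ε^{−1}Σ_ν(U(A_{⟨x−εe_ν,x⟩})*h(⟨x − εe_ν, x⟩) − h(⟨x, x + εe_ν⟩))`
(`B1Cor23DerivRegularRegion.siteInner_adjCovDeriv`). [cite: Balaban1982Higgs1, (1.7)–(1.8) p.605] -/
def adjA (C : ChargeData N) (A : HiggsLattice.VecField P 0) (h : HiggsLattice.PBond P 0 → E N) : ScalarField P 0 N :=
  fun x => (P.mesh 0)⁻¹ • ∑ ν : Fin P.d, (star (C.U (P.mesh 0) (A ⟨x.unshift ν, ν⟩)) (h ⟨x.unshift ν, ν⟩) - h ⟨x, ν⟩)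

end Support

/-! ## §2 The index set and the family -/

/-- An index of the family: torus, level (with `L^kε ≤ 1`), a region that is a union of `k`-fold blocks, vector field, effective coupling; the
member's pair of regions is the diagonal `(Ω, Ω)`. [cite: Balaban1983RegularityDecay, §1 pp.572–573, Cor. 2.3 p.580] -/
structure Cor23Idx (d L : ℕ) where
  /-- the torus of the carrier -/
  P : HiggsLattice.Params
  hPd : P.d = d
  hPL : P.L = L
  /-- the level `k` -/
  k : ℕ
  hk1 : 1 ≤ k
  hk : k ≤ P.K
  hs : P.mesh k ≤ 1
  /-- the region `Ω ⊂ T_ε`, a union of `k`-fold blocks -/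
  Ω : Finset (HiggsLattice.Site P 0)
  hΩ : ∀ x x' : HiggsLattice.Site P 0, blockIter k x = blockIter k x' → (x ∈ Ω ↔ x' ∈ Ω)
  /-- the vector field on the bonds of `T_ε` -/
  A : HiggsLattice.VecField P 0
  /-- the effective coupling `e_k` -/
  ec : ℝ

namespace Cor23Idx

variable {d L : ℕ} (i : Cor23Idx d L) (C : ChargeData N) (a msq : ℝ)

/-- Fields *"defined on Ω"* (extended by `0`). [cite: Balaban1983RegularityDecay, Cor. 2.3 p.580] -/
abbrev SrcΩ (i : Cor23Idx d L) (N : ℕ) : Type := {f : ScalarField i.P 0 N // ∀ x, x ∉ i.Ω → f x = 0}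

/-- `G^ε_k(Ω,A)` of the member. [cite: Balaban1982Higgs1, (2.20) p.610] -/
abbrev G : ScalarField i.P 0 N →ₗ[ℝ] ScalarField i.P 0 N := propagatorK C i.Ω i.A msq a i.k

/-- `δG^ε_k(Ω,Ω₀,A) = G^ε_k(Ω,A) − G^ε_k(Ω₀,A)` of the member, `Ω₀ := Ω` (diagonal). [cite: Balaban1983RegularityDecay, (1.11) p.573] -/
abbrev dG : ScalarField i.P 0 N →ₗ[ℝ] ScalarField i.P 0 N := propagatorK C i.Ω i.A msq a i.k - propagatorK C i.Ω i.A msq a i.k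

/-- The four pairings of (2.30) for an operator `T` in place of `G_k(Ω,A)`: `n = 0,1,2,3` ↦ `|⟨f, Tf′⟩|`, `|⟨h_{f,μ}, D^ε_ATf′⟩|`, `|⟨f, TD^{ε*}_Ah_{f′,ν}⟩|`,
`|⟨h_{f,μ}, D^ε_ATD^{ε*}_Ah_{f′,ν}⟩|`. [cite: Balaban1983RegularityDecay, Cor. 2.3 (2.30) p.580] -/
def pairT (T : ScalarField i.P 0 N →ₗ[ℝ] ScalarField i.P 0 N) (n : Fin 4) (μ ν : Fin i.P.d) (f f' : i.SrcΩ N) : ℝ :=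
  match n with
  | 0 => |siteInner f.1 (T f'.1)|
  | 1 => |bondInner (bf i.Ω μ f.1) (covDeriv C i.A (T f'.1))|
  | 2 => |siteInner f.1 (T (adjA C i.A (bf i.Ω ν f'.1)))|
  | 3 => |bondInner (bf i.Ω μ f.1) (covDeriv C i.A (T (adjA C i.A (bf i.Ω ν f'.1))))|

/-- The pairings of the zero operator vanish. [folklore] -/
private theorem pairT_zero (n : Fin 4) (μ ν : Fin i.P.d) (f f' : i.SrcΩ N) : i.pairT C (0 : ScalarField i.P 0 N →ₗ[ℝ] ScalarField i.P 0 N) n μ ν f f' = 0 := by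
  have hcov : ∀ b : HiggsLattice.PBond i.P 0, covDeriv C i.A (0 : ScalarField i.P 0 N) b = 0 := by
    intro b
    rw [B1Cor23RegularRegion.covDeriv_eq]
    simp
  have hb0 : ∀ h : HiggsLattice.PBond i.P 0 → E N, bondInner h (covDeriv C i.A (0 : ScalarField i.P 0 N)) = 0 := by
    intro h
    unfold bondInner
    exact Finset.sum_eq_zero fun b _ => by rw [hcov b, inner_zero_right, mul_zero]
  have hs0 : ∀ g : ScalarField i.P 0 N, siteInner g (0 : ScalarField i.P 0 N) = 0 := by
    intro g
    unfold siteInner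
    exact Finset.sum_eq_zero fun x _ => by rw [Pi.zero_apply, inner_zero_right, mul_zero]
  match n with
  | 0 => simp only [pairT, LinearMap.zero_apply, hs0, abs_zero]
  | 1 => simp only [pairT, LinearMap.zero_apply, hb0, abs_zero]
  | 2 => simp only [pairT, LinearMap.zero_apply, hs0, abs_zero]
  | 3 => simp only [pairT, LinearMap.zero_apply, hb0, abs_zero]

end Cor23Idx

/-- **THE FAMILY OF `EtaSetting`s OF THE (Higgs)₂,₃ CARRIER FOR COR. 2.3 ON REGIONS AT A REGULAR FIELD, DIAGONAL PAIRS** (module docstring «THE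
FAMILY» for the reading of each field). [cite: Balaban1983RegularityDecay, Cor. 2.3 (2.30) p.580, (1.11) p.573] [cite: Balaban1982Higgs1, (2.20)–(2.23) p.610] -/
def regDiagFam23 (d L : ℕ) (C : ChargeData N) (a msq creg β : ℝ) (i : Cor23Idx d L) : EtaSetting where
  Site := HiggsLattice.Site i.P 0
  Dir := Fin i.P.d
  Src := i.SrcΩ N
  e := i.ec
  regular := ∀ z ∈ i.Ω, ∀ μ ν : Fin i.P.d,
    i.P.mesh i.k * |C.e| / i.ec * |i.A ⟨z.shift ν, μ⟩ - i.A ⟨z, μ⟩| ≤ creg * i.ec ^ (β - 1) / (i.P.L : ℝ) ^ i.k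
  bigBlocks := True
  rect := False
  pdist := fun x y => (HiggsLattice.Site.tdist x y : ℝ) / (i.P.L : ℝ) ^ i.k
  sdist1 := fun _ _ => 0
  sdist2 := fun _ _ _ => 0
  bdist1 := fun _ => 0
  bdist2 := fun _ _ => 0
  bdistS := fun _ => 0
  supNorm := fun f => ‖f.1‖
  l2Norm := fun f => Real.sqrt (siteInner f.1 f.1)
  ssdist := fun f f' => ssdistSteps f.1 f'.1 / (i.P.L : ℝ) ^ i.k
  lhs19 := fun _ _ _ _ _ => 0
  valDG := fun _ _ _ => 0
  valG := fun _ _ => 0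
  dlhs19 := fun _ _ _ _ _ => 0
  dvalDG := fun _ _ _ => 0
  dvalG := fun _ _ => 0
  lower18 := fun _ => True
  pair := fun n μ ν f f' => i.pairT C (i.G C a msq) n μ ν f f'
  dpair := fun n μ ν f f' => i.pairT C (i.dG C a msq) n μ ν f f'

/-- **On the diagonal `Ω₀ = Ω` the `δG_k` pairings VANISH** (`δG_k(Ω,Ω,A) = G_k(Ω,A) − G_k(Ω,A) = 0`, literally). [cite: Balaban1983RegularityDecay, (1.11) p.573] -/
theorem dpair_eq_zero (d L : ℕ) (C : ChargeData N) (a msq creg β : ℝ) (i : Cor23Idx d L) (n : Fin 4)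
    (μ ν : (regDiagFam23 d L C a msq creg β i).Dir) (f f' : (regDiagFam23 d L C a msq creg β i).Src) :
    (regDiagFam23 d L C a msq creg β i).dpair n μ ν f f' = 0 := by
  show i.pairT C (i.dG C a msq) n μ ν f f' = 0
  have h0 : i.dG C a msq = 0 := sub_self _
  rw [h0]
  exact i.pairT_zero C n μ ν f f'

/-! ## §3 The typed Corollary 2.3 on the family -/

set_option maxHeartbeats 800000 in
/-- **[13] COROLLARY 2.3 IN b04's TYPED FORM `B4.Cor23Printed` HOLDS ON THE CONCRETE-CARRIER FAMILY `regDiagFam23`**: for `d`, `L ≧ 2`, `a > 0`,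
`m² > 0`, `N`, `(e, q)`, `c ≧ 0`, `β > 0` there are `c₀, δ₀, e₁ > 0` such that EVERY member (torus with these `d, L`, level with `L^kε ≤ 1`, block-union
region `Ω`, field `A`, coupling `e_k`) which is (2.23)-regular at the sites of `Ω` with `0 < e_k ≦ e₁` satisfies all four pairing bounds (2.30) with
`c₀e^{−δ₀dist(supp f, supp f′)}‖f‖₂‖f′‖₂` for all `f, f′` defined on `Ω` and all directions, and the `δG_k(Ω,Ω,A)` clauses (trivially, `δG = 0`).
Constants: `δ₀ = min{δ₁, δ₂}`, `c₀ = (c₁ + c₂)e^{δ₂}` from `cor23_first_regular_region` / `cor23_deriv_regular_region`, `e₁ = (3(d²c + 1))^{−1/β}`.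
[cite: Balaban1983RegularityDecay, Cor. 2.3 (2.30) p.580] [cite: Balaban1982Higgs1, Prop. 2.1 (2.23) p.610] -/
theorem cor23Printed_regDiagFam23 (d L : ℕ) (hL : 2 ≤ L) {a : ℝ} (ha : 0 < a) {msq : ℝ} (hmsq : 0 < msq) (C : ChargeData N)
    {creg : ℝ} (hcreg : 0 ≤ creg) {β : ℝ} (hβ : 0 < β) :
    Cor23Printed (regDiagFam23 d L C a msq creg β) := by
  have hL1 : 1 < L := by omega
  obtain ⟨δ₁, c₁, hδ₁, hc₁, H1⟩ := cor23_first_regular_region d L hL1 ha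
  obtain ⟨δ₂, c₂, hδ₂, hc₂, H2⟩ := cor23_deriv_regular_region d L hL1 ha
  obtain ⟨e₁, he₁, hsm⟩ := threshold_reg223 d hcreg hβ
  refine ⟨(c₁ + c₂) * Real.exp δ₂, min δ₁ δ₂, e₁, by positivity, lt_min hδ₁ hδ₂, he₁, ?_⟩
  intro i hreg _ hec hle n μ ν f f'
  have hdp := dpair_eq_zero d L C a msq creg β i n μ ν f f'
  dsimp only [regDiagFam23] at hreg hec hle hdp ⊢
  rw [hdp]
  -- the δ_A currency of r14's threshold
  have hsmall : (i.P.d : ℝ) ^ 2 * creg * i.ec ^ β ≤ 1 / 3 := by rw [i.hPd]; exact hsm i.ec hec hle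
  obtain ⟨δA, hregA, hsmallA⟩ := exists_deltaA_of_reg223 C i.Ω i.A hec hreg hsmall
  have hLk : (1 : ℝ) ≤ (i.P.L : ℝ) ^ i.k := by exact_mod_cast Nat.one_le_pow _ _ i.P.hL
  have hLpos : (0 : ℝ) < (i.P.L : ℝ) ^ i.k := by linarith
  set s : ℝ := ssdistSteps f.1 f'.1 with hs_def
  have hs0 : 0 ≤ s := ssdistSteps_nonneg _ _
  have hF := Real.sqrt_nonneg (siteInner f.1 f.1)
  have hF' := Real.sqrt_nonneg (siteInner f'.1 f'.1)
  -- the common weakening `c e^{−δ s/L^k} ≤ c₀ e^{−min δ · s/L^k}`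
  have weak : ∀ {c δ : ℝ}, 0 ≤ c → c ≤ (c₁ + c₂) * Real.exp δ₂ → min δ₁ δ₂ ≤ δ →
      ∀ {X : ℝ}, 0 ≤ X → c * Real.exp (-(δ * (s / (i.P.L : ℝ) ^ i.k))) * X
        ≤ (c₁ + c₂) * Real.exp δ₂ * Real.exp (-(min δ₁ δ₂ * (s / (i.P.L : ℝ) ^ i.k))) * X := by
    intro c δ hc0 hcle hδle X hX
    have hsq : 0 ≤ s / (i.P.L : ℝ) ^ i.k := div_nonneg hs0 hLpos.le
    have h1 : Real.exp (-(δ * (s / (i.P.L : ℝ) ^ i.k))) ≤ Real.exp (-(min δ₁ δ₂ * (s / (i.P.L : ℝ) ^ i.k))) :=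
      Real.exp_le_exp.2 (by nlinarith)
    have h2 : c * Real.exp (-(δ * (s / (i.P.L : ℝ) ^ i.k)))
        ≤ (c₁ + c₂) * Real.exp δ₂ * Real.exp (-(min δ₁ δ₂ * (s / (i.P.L : ℝ) ^ i.k))) :=
      (mul_le_mul_of_nonneg_right hcle (Real.exp_nonneg _)).trans
        (mul_le_mul_of_nonneg_left h1 (by positivity))
    exact mul_le_mul_of_nonneg_right h2 hX
  have hE2 : 1 ≤ Real.exp δ₂ := Real.one_le_exp hδ₂.le
  have hc₁le : c₁ ≤ (c₁ + c₂) * Real.exp δ₂ := by nlinarith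
  have hc₂le : c₂ ≤ (c₁ + c₂) * Real.exp δ₂ := by nlinarith
  have hc₂e : c₂ * Real.exp δ₂ ≤ (c₁ + c₂) * Real.exp δ₂ := by nlinarith [Real.exp_pos δ₂]
  have hRHS0 : 0 ≤ (c₁ + c₂) * Real.exp δ₂ * Real.exp (-(min δ₁ δ₂ * (s / (i.P.L : ℝ) ^ i.k))) *
      Real.sqrt (siteInner f.1 f.1) * Real.sqrt (siteInner f'.1 f'.1) := by positivity
  have hc0 : 0 ≤ (c₁ + c₂) * Real.exp δ₂ := by positivity
  refine ⟨?_, mul_nonneg (mul_nonneg (mul_nonneg (mul_nonneg hc0 (Real.exp_nonneg _)) (Real.exp_nonneg _)) hF) hF'⟩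
  have H1i := H1 i.P i.hPd i.hPL N C msq hmsq i.k i.hk1 i.hk i.hs i.Ω i.hΩ i.A δA hregA hsmallA
  have H2i := H2 i.P i.hPd i.hPL N C msq hmsq i.k i.hk1 i.hk i.hs i.Ω i.hΩ i.A δA hregA hsmallA
  clear H1 H2
  -- `e^{−δ₂(s−1)/L^k} ≤ e^{δ₂}e^{−δ₂ s/L^k}` (used for the fourth pairing)
  have hexp : Real.exp (-(δ₂ * ((s - 1) / (i.P.L : ℝ) ^ i.k))) ≤ Real.exp δ₂ * Real.exp (-(δ₂ * (s / (i.P.L : ℝ) ^ i.k))) := by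
    rw [← Real.exp_add]
    apply Real.exp_le_exp.2
    have h1 : δ₂ * ((s - 1) / (i.P.L : ℝ) ^ i.k) = δ₂ * (s / (i.P.L : ℝ) ^ i.k) - δ₂ / (i.P.L : ℝ) ^ i.k := by
      rw [sub_div, mul_sub, mul_one_div]
    have h2 : δ₂ / (i.P.L : ℝ) ^ i.k ≤ δ₂ := div_le_self hδ₂.le hLk
    linarith
  match n with
  | 0 =>
    simp only [Cor23Idx.pairT]
    have hsep : ∀ x x', f.1 x ≠ 0 → f'.1 x' ≠ 0 → s ≤ (HiggsLattice.Site.tdist x x' : ℝ) :=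
      fun x x' hx hx' => ssdistSteps_le hx hx'
    have h := H1i s f.1 f'.1 f'.2 hsep
    calc _ ≤ _ := h
      _ = c₁ * Real.exp (-(δ₁ * (s / (i.P.L : ℝ) ^ i.k))) * (Real.sqrt (siteInner f.1 f.1) * Real.sqrt (siteInner f'.1 f'.1)) := by
          ring
      _ ≤ (c₁ + c₂) * Real.exp δ₂ * Real.exp (-(min δ₁ δ₂ * (s / (i.P.L : ℝ) ^ i.k))) *
            (Real.sqrt (siteInner f.1 f.1) * Real.sqrt (siteInner f'.1 f'.1)) :=
          weak hc₁.le hc₁le (min_le_left _ _) (mul_nonneg hF hF')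
      _ = _ := by ring
  | 1 =>
    simp only [Cor23Idx.pairT]
    have hsep : ∀ (b : HiggsLattice.PBond i.P 0) (x' : HiggsLattice.Site i.P 0), bf i.Ω μ f.1 b ≠ 0 → f'.1 x' ≠ 0 →
        s ≤ (HiggsLattice.Site.tdist b.src x' : ℝ) := fun b x' hb hx' => ssdistSteps_le (bf_ne_zero hb) hx'
    have h := (H2i s).1 (bf i.Ω μ f.1) f'.1 (bf_eq_zero_of_not_inside i.Ω μ f.1) hsep
    have hb := sqrt_bondInner_bf_le i.Ω μ f.1
    calc _ ≤ _ := h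
      _ ≤ c₂ * Real.exp (-(δ₂ * (s / (i.P.L : ℝ) ^ i.k))) * Real.sqrt (siteInner f.1 f.1) * Real.sqrt (siteInner f'.1 f'.1) := by
          have := mul_le_mul_of_nonneg_right (mul_le_mul_of_nonneg_left hb
            (show 0 ≤ c₂ * Real.exp (-(δ₂ * (s / (i.P.L : ℝ) ^ i.k))) by positivity)) hF'
          exact this
      _ = c₂ * Real.exp (-(δ₂ * (s / (i.P.L : ℝ) ^ i.k))) * (Real.sqrt (siteInner f.1 f.1) * Real.sqrt (siteInner f'.1 f'.1)) := by
          ring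
      _ ≤ (c₁ + c₂) * Real.exp δ₂ * Real.exp (-(min δ₁ δ₂ * (s / (i.P.L : ℝ) ^ i.k))) *
            (Real.sqrt (siteInner f.1 f.1) * Real.sqrt (siteInner f'.1 f'.1)) :=
          weak hc₂.le hc₂le (min_le_right _ _) (mul_nonneg hF hF')
      _ = _ := by ring
  | 2 =>
    simp only [Cor23Idx.pairT]
    have hsep : ∀ (b : HiggsLattice.PBond i.P 0) (x : HiggsLattice.Site i.P 0), bf i.Ω ν f'.1 b ≠ 0 → f.1 x ≠ 0 →
        s ≤ (HiggsLattice.Site.tdist b.src x : ℝ) := by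
      intro b x hb hx
      have h1 := ssdistSteps_le hx (bf_ne_zero hb)
      rwa [tdist_comm] at h1
    have h := (H2i s).2.1 f.1 (bf i.Ω ν f'.1) (bf_eq_zero_of_not_inside i.Ω ν f'.1) hsep
    have hb := sqrt_bondInner_bf_le i.Ω ν f'.1
    unfold adjA
    calc _ ≤ _ := h
      _ ≤ c₂ * Real.exp (-(δ₂ * (s / (i.P.L : ℝ) ^ i.k))) * Real.sqrt (siteInner f.1 f.1) * Real.sqrt (siteInner f'.1 f'.1) :=
          mul_le_mul_of_nonneg_left hb (by positivity)
      _ = c₂ * Real.exp (-(δ₂ * (s / (i.P.L : ℝ) ^ i.k))) * (Real.sqrt (siteInner f.1 f.1) * Real.sqrt (siteInner f'.1 f'.1)) := by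
          ring
      _ ≤ (c₁ + c₂) * Real.exp δ₂ * Real.exp (-(min δ₁ δ₂ * (s / (i.P.L : ℝ) ^ i.k))) *
            (Real.sqrt (siteInner f.1 f.1) * Real.sqrt (siteInner f'.1 f'.1)) :=
          weak hc₂.le hc₂le (min_le_right _ _) (mul_nonneg hF hF')
      _ = _ := by ring
  | 3 =>
    simp only [Cor23Idx.pairT]
    -- separation `s − 1` (the far endpoint of the source bond may be one step closer)
    have hsep : ∀ b b' : HiggsLattice.PBond i.P 0, bf i.Ω μ f.1 b ≠ 0 → bf i.Ω ν f'.1 b' ≠ 0 →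
        s - 1 ≤ (HiggsLattice.Site.tdist b.src b'.src : ℝ) ∧ s - 1 ≤ (HiggsLattice.Site.tdist b.src b'.tgt : ℝ) := by
      intro b b' hb hb'
      have h1 : s ≤ (HiggsLattice.Site.tdist b.src b'.src : ℝ) := ssdistSteps_le (bf_ne_zero hb) (bf_ne_zero hb')
      have h2 : (HiggsLattice.Site.tdist b.src b'.src : ℝ)
          ≤ (HiggsLattice.Site.tdist b.src b'.tgt : ℝ) + (HiggsLattice.Site.tdist b'.tgt b'.src : ℝ) := tdist_triangle_real _ _ _
      have h3 : (HiggsLattice.Site.tdist b'.tgt b'.src : ℝ) ≤ 1 := by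
        rw [tdist_comm]
        exact_mod_cast tdist_shift_le_one b'.src b'.dir
      constructor <;> linarith
    have h := (H2i (s - 1)).2.2 (bf i.Ω μ f.1) (bf i.Ω ν f'.1) (bf_eq_zero_of_not_inside i.Ω μ f.1)
      (bf_eq_zero_of_not_inside i.Ω ν f'.1) hsep
    have hb := sqrt_bondInner_bf_le i.Ω μ f.1
    have hb' := sqrt_bondInner_bf_le i.Ω ν f'.1
    have hbb := Real.sqrt_nonneg (bondInner (bf i.Ω ν f'.1) (bf i.Ω ν f'.1))
    unfold adjA
    calc _ ≤ _ := h
      _ ≤ c₂ * (Real.exp δ₂ * Real.exp (-(δ₂ * (s / (i.P.L : ℝ) ^ i.k)))) *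
            Real.sqrt (siteInner f.1 f.1) * Real.sqrt (siteInner f'.1 f'.1) := by
          have step1 := mul_le_mul_of_nonneg_left hexp hc₂.le
          have step2 : c₂ * Real.exp (-(δ₂ * ((s - 1) / (i.P.L : ℝ) ^ i.k))) * Real.sqrt (bondInner (bf i.Ω μ f.1) (bf i.Ω μ f.1))
              ≤ c₂ * (Real.exp δ₂ * Real.exp (-(δ₂ * (s / (i.P.L : ℝ) ^ i.k)))) * Real.sqrt (siteInner f.1 f.1) :=
            mul_le_mul step1 hb (Real.sqrt_nonneg _) (by positivity)
          exact mul_le_mul step2 hb' hbb (by positivity)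
      _ = c₂ * Real.exp δ₂ * Real.exp (-(δ₂ * (s / (i.P.L : ℝ) ^ i.k))) *
            (Real.sqrt (siteInner f.1 f.1) * Real.sqrt (siteInner f'.1 f'.1)) := by ring
      _ ≤ (c₁ + c₂) * Real.exp δ₂ * Real.exp (-(min δ₁ δ₂ * (s / (i.P.L : ℝ) ^ i.k))) *
            (Real.sqrt (siteInner f.1 f.1) * Real.sqrt (siteInner f'.1 f'.1)) :=
          weak (by positivity) hc₂e (min_le_right _ _) (mul_nonneg hF hF')
      _ = _ := by ring

/-- **The family is non-vacuous at every threshold**: for every torus with these `d, L`, every level `1 ≤ k ≤ K` with `L^kε ≤ 1`, every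
block-union region and every `0 < e_k ≦ e₁` the member with `A = 0` is `regular` (and `bigBlocks`). [cite: Balaban1983RegularityDecay, Cor. 2.3 p.580] -/
theorem regDiagFam23_nonvacuous {d L : ℕ} (C : ChargeData N) (a msq : ℝ) {creg : ℝ} (hcreg : 0 ≤ creg) (β : ℝ)
    (P : HiggsLattice.Params) (hPd : P.d = d) (hPL : P.L = L) {k : ℕ} (hk1 : 1 ≤ k) (hk : k ≤ P.K) (hs : P.mesh k ≤ 1)
    (Ω : Finset (HiggsLattice.Site P 0)) (hΩ : ∀ x x' : HiggsLattice.Site P 0, blockIter k x = blockIter k x' → (x ∈ Ω ↔ x' ∈ Ω))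
    {e₁ : ℝ} (he₁ : 0 < e₁) :
    ∃ i : Cor23Idx d L,
      (regDiagFam23 d L C a msq creg β i).regular ∧ (regDiagFam23 d L C a msq creg β i).bigBlocks ∧
      0 < (regDiagFam23 d L C a msq creg β i).e ∧ (regDiagFam23 d L C a msq creg β i).e ≤ e₁ := by
  refine ⟨⟨P, hPd, hPL, k, hk1, hk, hs, Ω, hΩ, 0, e₁⟩, ?_, trivial, he₁, le_rfl⟩
  dsimp only [regDiagFam23]
  intro z _ μ ν
  rw [Pi.zero_apply, Pi.zero_apply, sub_self, abs_zero, mul_zero]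
  have hL0 : (0 : ℝ) ≤ (P.L : ℝ) ^ k := by positivity
  exact div_nonneg (mul_nonneg hcreg (Real.rpow_nonneg he₁.le _)) hL0

end Literature.MathematicalPhysics.QuantumFieldTheory.Balaban1983to89.B1Cor23RegularDiagFam

end
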